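import Summits.BirchSwinnertonDyer.BirchSwinnertonDyer.Theses.MordellShaFreeCut
import Literature.NumberTheory.EllipticCurves.HeegnerFieldDescentProofs

/-! # Route `MordellShaFreeCut` (rung S2b) — crux `AnalyticRankOneOfRankOneFiniteShaThree`
(stmt-BirchSwinnertonDyer-19160), line `heegner-field-gz`: the registered stub
`stub_heegnerFieldData` from refereed named facts

The BC3 skeleton of the crux (plan g8, sha16 f9a75e4a) composes
`stub_heegnerFieldData → stub_threeConverseOverK → AnalyticRankOneOfRankOneFiniteShaThree`. Its first
stub — for `D ≠ 0` with `rank E_D(ℚ) = 1` and `Ш(E_D/ℚ)[3^∞]` finite there is an imaginary quadratic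
`K` with the Heegner hypothesis for the full conductor of the Mordell curve `E_D : y² = x³ + D` and
`3` split in `K`, over which `E_D` has Selmer corank one and rank one and whose twist contributes nothing to the
analytic rank — is fact-free as registered, but every printed input is a REFEREED named fact of the
tree: Greenberg's corank identity (a tree THEOREM), the `3`-parity theorem (`p_parity`), the
Modularity Theorem (`ModularForms.exists_isNewformOf`), Hoffstein–Luo 1997
(`HoffsteinLuo1997_exists_twist_L_one_ne_zero`) and Kato 2004 Cor. 14.3
(`kato_finite_of_L_one_ne_zero`). This file lands the BINDER-CARRYING form
`facts → <stub statement verbatim>` (the day-1 currency of GAP-LEDGER-read2-skeletons-g25, sk-3),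
by specialising the tree theorem
`exists_heegnerField_descent_of_mordellWeilRank_eq_one_of_finite_sha`
(`Literature/…/HeegnerFieldDescentProofs.lean`) to `W = mordellCurve D`, `p = 3`.
It supports, and does not close, the item: the load-bearing stub `stub_threeConverseOverK`
(Rubin/BDP-type formula + explicit reciprocity law at `p = 3` for the additive curve `E_D`;
Fan–Wan v2 Thm. 4.2/4.4 + 6.9, unrefereed) is untouched. -/

namespace Summit.BirchSwinnertonDyer.BirchSwinnertonDyer.Theorems.MordellShaFreeCutHeegnerFieldData

open Literature.NumberTheory.EllipticCurves WeierstrassCurve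

/-- **`stub_heegnerFieldData` of crux `AnalyticRankOneOfRankOneFiniteShaThree` from refereed facts**
(statement after the binders = the registered stub, token for token): for `D ≠ 0` with
`rank E_D(ℚ) = 1` and `Ш(E_D/ℚ)[3^∞]` finite there is an imaginary quadratic field `K` satisfying
the Heegner hypothesis for `N(E_D)` and for `3`, with `corank_{ℤ₃} Sel_{3^∞}(E_D/K) = 1`,
`rank E_D(K) = 1` and `ord_{s=1} L(E_D/K, s) = ord_{s=1} L(E_D, s)` — granted `3`-parity (`hpar`),
modularity (`hmod`), Hoffstein–Luo (`hHL`) and Kato (`hKato`). -/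
theorem heegnerFieldData_of_parity_of_hoffsteinLuo_of_kato
    (hpar : ∀ (W : WeierstrassCurve ℚ) [W.IsElliptic] (p : ℕ) [Fact p.Prime], p_parity W p)
    (hmod : ModularForms.exists_isNewformOf) (hHL : HoffsteinLuo1997_exists_twist_L_one_ne_zero)
    (hKato : ∀ (W : WeierstrassCurve ℚ) [W.IsElliptic] (p : ℕ) [Fact p.Prime],
      kato_finite_of_L_one_ne_zero W p) :
    ∀ ⦃D : ℚ⦄, D ≠ 0 → (mordellCurve D).mordellWeilRank = 1 →
      Finite (AddCommGroup.primaryComponent (mordellCurve D).sha 3) →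
        ∃ (K : Type) (_ : Field K) (_ : NumberField K),
          IsImaginaryQuadratic K ∧
            SatisfiesHeegnerHypothesis ((mordellCurve D).conductorNorm ℤ) K ∧
              SatisfiesHeegnerHypothesis 3 K ∧
                ((mordellCurve D).baseChange K).selmerCorank 3 = 1 ∧
                  ((mordellCurve D).baseChange K).mordellWeilRank = 1 ∧
                    analyticRankEK (mordellCurve D) K = (mordellCurve D).analyticRank := by
  intro D hD hrank hsha
  haveI := isElliptic_mordellCurve hD
  obtain ⟨K, _, _, hK, -, hHN, hH3, -, -, hcK, hrK, han⟩ :=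
    exists_heegnerField_descent_of_mordellWeilRank_eq_one_of_finite_sha hpar hmod hHL hKato
      (mordellCurve D) 3 hrank hsha 0
  exact ⟨K, inferInstance, inferInstance, hK, hHN, hH3, hcK, hrK, han⟩

/-- **The same field with the extra data `|d_K| > B`, `d_K ≡ 1 (mod 8)` and
`L(E_D^{(d_K)}, 1) ≠ 0`** — what a `K`-level argument for `stub_threeConverseOverK` may consume
beyond the registered conjuncts, from the same four refereed facts. -/
theorem heegnerFieldData_full_of_parity_of_hoffsteinLuo_of_kato
    (hpar : ∀ (W : WeierstrassCurve ℚ) [W.IsElliptic] (p : ℕ) [Fact p.Prime], p_parity W p)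
    (hmod : ModularForms.exists_isNewformOf) (hHL : HoffsteinLuo1997_exists_twist_L_one_ne_zero)
    (hKato : ∀ (W : WeierstrassCurve ℚ) [W.IsElliptic] (p : ℕ) [Fact p.Prime],
      kato_finite_of_L_one_ne_zero W p)
    {D : ℚ} (hD : D ≠ 0) (hrank : (mordellCurve D).mordellWeilRank = 1)
    (hsha : Finite (AddCommGroup.primaryComponent (mordellCurve D).sha 3)) (B : ℕ) :
    ∃ (K : Type) (_ : Field K) (_ : NumberField K),
      IsImaginaryQuadratic K ∧ B < (NumberField.discr K).natAbs ∧
        SatisfiesHeegnerHypothesis ((mordellCurve D).conductorNorm ℤ) K ∧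
          SatisfiesHeegnerHypothesis 3 K ∧ NumberField.discr K % 8 = 1 ∧
            ((mordellCurve D).quadraticTwist (NumberField.discr K : ℚ)).entireLFunction 1 ≠ 0 ∧
              ((mordellCurve D).baseChange K).selmerCorank 3 = 1 ∧
                ((mordellCurve D).baseChange K).mordellWeilRank = 1 ∧
                  analyticRankEK (mordellCurve D) K = (mordellCurve D).analyticRank := by
  haveI := isElliptic_mordellCurve hD
  exact exists_heegnerField_descent_of_mordellWeilRank_eq_one_of_finite_sha hpar hmod hHL hKato
    (mordellCurve D) 3 hrank hsha B

end Summit.BirchSwinnertonDyer.BirchSwinnertonDyer.Theorems.MordellShaFreeCutHeegnerFieldData
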